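import Literature.NumberTheory.Rogawski1990.ArchChartOrbGIsolateFinset   -- ★ (J-iso)^T (F0P3a-p05 (g21)) §1: `chartOrbG_eq_prod_mul_integral_integral_isolate_pred_of_regG` (ANY `p`), `descConj_assembleQuotient_pred_eq`
import Mathlib.MeasureTheory.Integral.Pi
import HarnessLib

/-!
# `chartOrbG` of a MIXED tensor (the isolated places `p` may MEET the label `S′`): the `p`-side is the product of the LOCAL quotient readings of the one-place generators
# («(F2) MIXED TENSOR AT LABELS MEETING `D`» on ★ (J-iso)^T §1; Folland 1995 §2.2, §2.6 (2.52); Rogawski 1990 §8.2–8.3; Borel–Jacquet 1979 §4.1)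

Topic `NumberTheory/Rogawski1990`; namespace `Literature.NumberTheory.Automorphic.UnitaryGroup`.  THEOREMS ONLY (no `def`, no instance, no notation, no axiom, no named fact,
no `sorry`).  Cell `pub/hodgecm-mathlib`, crux H413 (`stmt-HodgeConjecture-24833`), F0∕P3c line LH2 «N8-INNER», ROAD B «EULER–POINCARÉ ROAD» (dealer LH2-plan (g1), brick (F2)
dealt 2026-09-02T16:20:47Z), seat F0P2-p02 (g21).  Sibling of (F) `ArchChartOrbGTensorOverPlaces` ∕ (F1′) `…TensorOverPlacesLoc` (which need `p w → w ∉ S′`).  Count-neutral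
measure-theoretic bookkeeping: nothing here closes an organ.

THE MATHEMATICS.  ★ (J-iso)^T §1 `chartOrbG_eq_prod_mul_integral_integral_isolate_pred_of_regG` holds for ANY decidable predicate `p` on the complex places (no compactness): the
`p`-places OUTSIDE as local QUOTIENTS `Π_{p}(U_w ⧸ T′_{S′,w})` against `⊗_{p} (ν′_w ∕ t_w)`, the `¬p`-places INSIDE.  For a test function which is, in the product coordinates
`e⁻¹ ∘ (piEquivPiSubtypeProd … p)⁻¹`, a MIXED TENSOR `a′(e⁻¹(x, y)) = (Π_{w : p} b_w(x_w)) · u(e⁻¹(x, y))` (`hf`) with `u` invariant under conjugation of the `p`-coordinates at the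
orbit (`hu`), the iterated integral factors (Fubini on the finite product `Π_{p}`, Mathlib `integral_fintype_prod_eq_prod`; the `ẏ`-independent inner integral pulled out):
  **`chartOrbG ν′ S′ a′ c = (Π_{w : p} t_w(B′_w) · ∫_{U_w ⧸ T′_w} b_w(ẏ γ_w(c) ẏ⁻¹) d(ν′_w ∕ t_w)(ẏ)) · ((Π_{w′ : ¬p} t_{w′}(B′_{w′})) · ∫_{Π_{¬p}(U_{w′} ⧸ T′_{w′})} u(e⁻¹((γ_w(c))_{p}, (ḃγḃ⁻¹)_{¬p})) d⊗(ν′∕t))`**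
(`chartOrbG_eq_prod_quotient_mul_integral_of_tensor`).  Each `p`-factor `t_w(B′_w) · ∫_{U_w⧸T′_w} b_w(ẏ γ_w ẏ⁻¹) d(ν′_w∕t_w)` IS the local functional
`chartOrbGLoc L α w S′ ν′_w b_w (c w)` by ★ `chartOrbGLoc_eq_of_isHaarMeasure (t w)` (Haar-freeness) — at a SPLIT place `w ∈ S′ ∩ {p}` the split-chart one-place reading, at a
compact place the whole-group orbital integral (★ `chartOrbGLoc_eq_integral_of_not_mem`, cf. (F1′)); the rewrite is the consumer's, in its `borel` quotient σ-algebra (the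
`[MeasurableSpace (U_w ⧸ T′_w)]` binder of ★ (J-iso)^T is abstract, `chartOrbGLoc` bakes `borel`).  USE ((12′) E3, (T2)): ONE vanishing split reading
`chartOrbGLoc_w(b_w)(c w) = 0` at a place `w ∈ S′ ∩ D` kills `chartOrbG` of the whole tensor on every label `S′` meeting `D`.
HONEST LABEL: HC_CM is proved only modulo the 7 printed citations (2 remaining: hLiu418 = `stmt-HodgeConjecture-24832`, h413 = `stmt-HodgeConjecture-24833`) until rung 0 closes;
this file moves no row of the books.

## References
* [Folland1995] G. B. Folland, *A Course in Abstract Harmonic Analysis* (1995), §2.2 (product measures, Fubini), §2.6 (2.52).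
* [Rogawski1990] J. D. Rogawski, *Automorphic Representations of Unitary Groups in Three Variables*, Ann. of Math. Stud. 123 (1990), §8.2 p. 122, §8.3 p. 124.
* [BorelJacquet1979] A. Borel, H. Jacquet, *Automorphic forms and automorphic representations*, PSPM 33.1 (1979), §4.1.
-/

set_option autoImplicit false

noncomputable section

open MeasureTheory MeasureTheory.Measure NumberField NumberField.InfinitePlace Matrix Complex Topology
open Literature.MeasureTheory.Group Literature.NumberTheory.Rogawski1990
open scoped MatrixGroups Matrix Classical ENNReal NNReal

namespace Literature.NumberTheory.Automorphic.UnitaryGroup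

section TensorMixed

variable (L : Type) [Field L] [NumberField L] [IsCMField L] (α : Fin 3 → L) (S' : Finset {w : InfinitePlace L // IsComplex w})
  [∀ w : {w : InfinitePlace L // IsComplex w}, MeasurableSpace ↥(archLocal L 3 (Matrix.diagonal α) w)]
  [∀ w : {w : InfinitePlace L // IsComplex w}, BorelSpace ↥(archLocal L 3 (Matrix.diagonal α) w)]
  [∀ w : {w : InfinitePlace L // IsComplex w}, LocallyCompactSpace ↥(archLocal L 3 (Matrix.diagonal α) w)]
  [∀ w : {w : InfinitePlace L // IsComplex w}, SecondCountableTopology ↥(archLocal L 3 (Matrix.diagonal α) w)]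
  [MeasurableSpace ↥(arch (↥(maximalRealSubfield L)) L (IsCMField.complexConj L) 3 (Matrix.diagonal α))]
  [BorelSpace ↥(arch (↥(maximalRealSubfield L)) L (IsCMField.complexConj L) 3 (Matrix.diagonal α))]
  [∀ w : {w : InfinitePlace L // IsComplex w}, MeasurableSpace (↥(archLocal L 3 (Matrix.diagonal α) w) ⧸ chartTorusGLoc L α w S')]
  [∀ w : {w : InfinitePlace L // IsComplex w}, BorelSpace (↥(archLocal L 3 (Matrix.diagonal α) w) ⧸ chartTorusGLoc L α w S')]
  (ν'w : ∀ w : {w : InfinitePlace L // IsComplex w}, Measure ↥(archLocal L 3 (Matrix.diagonal α) w)) [∀ w, (ν'w w).IsHaarMeasure] [∀ w, (ν'w w).IsMulRightInvariant]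
  (ν' : Measure ↥(arch (↥(maximalRealSubfield L)) L (IsCMField.complexConj L) 3 (Matrix.diagonal α))) [ν'.IsHaarMeasure] [ν'.IsMulRightInvariant]
  (hν : ν' = (Measure.pi ν'w).map (archPiEquivCM 3 L (Matrix.diagonal α)).symm)
  (t : ∀ w : {w : InfinitePlace L // IsComplex w}, Measure ↥(chartTorusGLoc L α w S')) [∀ w, (t w).IsHaarMeasure] [∀ w, (t w).IsInvInvariant]
  (p : {w : InfinitePlace L // IsComplex w} → Prop) [DecidablePred p]
  [Fintype {w : {w : InfinitePlace L // IsComplex w} // p w}] [Fintype {w : {w : InfinitePlace L // IsComplex w} // ¬ p w}]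

omit [∀ w : {w : InfinitePlace L // IsComplex w}, BorelSpace ↥(archLocal L 3 (Matrix.diagonal α) w)]
  [∀ w : {w : InfinitePlace L // IsComplex w}, LocallyCompactSpace ↥(archLocal L 3 (Matrix.diagonal α) w)]
  [∀ w : {w : InfinitePlace L // IsComplex w}, SecondCountableTopology ↥(archLocal L 3 (Matrix.diagonal α) w)]
  [∀ w : {w : InfinitePlace L // IsComplex w}, BorelSpace (↥(archLocal L 3 (Matrix.diagonal α) w) ⧸ chartTorusGLoc L α w S')]
  [MeasurableSpace ↥(arch (↥(maximalRealSubfield L)) L (IsCMField.complexConj L) 3 (Matrix.diagonal α))]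
  [BorelSpace ↥(arch (↥(maximalRealSubfield L)) L (IsCMField.complexConj L) 3 (Matrix.diagonal α))]
  [Fintype {w : {w : InfinitePlace L // IsComplex w} // p w}] [Fintype {w : {w : InfinitePlace L // IsComplex w} // ¬ p w}] [DecidablePred p]
  [∀ w : {w : InfinitePlace L // IsComplex w}, MeasurableSpace ↥(archLocal L 3 (Matrix.diagonal α) w)]
  [∀ w : {w : InfinitePlace L // IsComplex w}, MeasurableSpace (↥(archLocal L 3 (Matrix.diagonal α) w) ⧸ chartTorusGLoc L α w S')] in
/-- The conjugated quotient point, on a representative: `descConj γ T′ _ id ẏ = y γ y⁻¹` with `y := ẏ.out`. [cite: Folland1995, §2.6 (2.52)] -/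
theorem descConj_id_eq_out_conj (c : {w : InfinitePlace L // IsComplex w} → Fin 3 → ℝ) (w : {w : InfinitePlace L // IsComplex w})
    (y : ↥(archLocal L 3 (Matrix.diagonal α) w) ⧸ chartTorusGLoc L α w S') :
    descConj (gprimeBlockAt L α w S' (c w)) (chartTorusGLoc L α w S') (forall_mem_chartTorusGLoc_comm L α w S' (c w)) id y =
      y.out * gprimeBlockAt L α w S' (c w) * y.out⁻¹ := by
  conv_lhs => rw [← QuotientGroup.out_eq' y]
  rfl

include hν in
/-- **(F2) MIXED TENSOR — THE `p`-PLACES MAY MEET `S′`.**  Binders of ★ (J-iso)^T (`p` ANY decidable predicate), `c ∈ RegG S′`, `a′ ∈ C_c`, one-place generators `b_w` at the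
`p`-places, and `u` with the tensor shape `hf` and the orbit-conjugation invariance `hu` of (F).  Then `chartOrbG ν′ S′ a′ c` is the PRODUCT over the `p`-places of the local quotient
readings `t_w(B′_w) · ∫_{U_w⧸T′_w} b_w(ẏ γ_w(c) ẏ⁻¹) d(ν′_w∕t_w)` (= `chartOrbGLoc L α w S′ ν′_w b_w (c w)` by ★ `chartOrbGLoc_eq_of_isHaarMeasure`, split or compact alike) times the `¬p`-side
reading of `u(γ_p(c), ·)` with its box constants. [cite: Folland1995, §2.2; §2.6 (2.52)] [cite: Rogawski1990, §8.2 p. 122; §8.3 p. 124] [cite: BorelJacquet1979, §4.1] -/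
theorem chartOrbG_eq_prod_quotient_mul_integral_of_tensor (hα : ∀ i, α i ≠ 0) (hS' : ∀ w, w ∈ S' → w ∈ splitChartPlaces L α)
    {c : {w : InfinitePlace L // IsComplex w} → Fin 3 → ℝ} (hc : c ∈ ArchCartan.RegG S')
    {a' : ↥(arch (↥(maximalRealSubfield L)) L (IsCMField.complexConj L) 3 (Matrix.diagonal α)) → ℂ} (ha'c : Continuous a') (ha's : HasCompactSupport a')
    (bw : ∀ w : {w : {w : InfinitePlace L // IsComplex w} // p w}, ↥(archLocal L 3 (Matrix.diagonal α) w.1) → ℂ)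
    (u : ↥(arch (↥(maximalRealSubfield L)) L (IsCMField.complexConj L) 3 (Matrix.diagonal α)) → ℂ)
    (hf : ∀ (x : ∀ w : {w : {w : InfinitePlace L // IsComplex w} // p w}, ↥(archLocal L 3 (Matrix.diagonal α) w.1))
      (y : ∀ w' : {w : {w : InfinitePlace L // IsComplex w} // ¬ p w}, ↥(archLocal L 3 (Matrix.diagonal α) w'.1)),
      a' ((archPiEquivCM 3 L (Matrix.diagonal α)).symm
        ((MeasurableEquiv.piEquivPiSubtypeProd (fun w : {w : InfinitePlace L // IsComplex w} => ↥(archLocal L 3 (Matrix.diagonal α) w)) p).symm (x, y))) =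
      (∏ w, bw w (x w)) * u ((archPiEquivCM 3 L (Matrix.diagonal α)).symm
        ((MeasurableEquiv.piEquivPiSubtypeProd (fun w : {w : InfinitePlace L // IsComplex w} => ↥(archLocal L 3 (Matrix.diagonal α) w)) p).symm (x, y))))
    (hu : ∀ (g : ∀ w : {w : {w : InfinitePlace L // IsComplex w} // p w}, ↥(archLocal L 3 (Matrix.diagonal α) w.1))
      (y : ∀ w' : {w : {w : InfinitePlace L // IsComplex w} // ¬ p w}, ↥(archLocal L 3 (Matrix.diagonal α) w'.1)),
      u ((archPiEquivCM 3 L (Matrix.diagonal α)).symm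
        ((MeasurableEquiv.piEquivPiSubtypeProd (fun w : {w : InfinitePlace L // IsComplex w} => ↥(archLocal L 3 (Matrix.diagonal α) w)) p).symm
          (fun w => g w * gprimeBlockAt L α w.1 S' (c w.1) * (g w)⁻¹, y))) =
      u ((archPiEquivCM 3 L (Matrix.diagonal α)).symm
        ((MeasurableEquiv.piEquivPiSubtypeProd (fun w : {w : InfinitePlace L // IsComplex w} => ↥(archLocal L 3 (Matrix.diagonal α) w)) p).symm
          (fun w => gprimeBlockAt L α w.1 S' (c w.1), y)))) :
    chartOrbG L α ν' S' a' c =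
      (∏ w : {w : {w : InfinitePlace L // IsComplex w} // p w},
          (((t w.1 (chartBoxImgGLoc L α w.1 S')).toReal : ℂ) *
            ∫ y : ↥(archLocal L 3 (Matrix.diagonal α) w.1) ⧸ chartTorusGLoc L α w.1 S',
              bw w (descConj (gprimeBlockAt L α w.1 S' (c w.1)) (chartTorusGLoc L α w.1 S') (forall_mem_chartTorusGLoc_comm L α w.1 S' (c w.1)) id y)
              ∂(quotientMeasure (chartTorusGLoc L α w.1 S') (t w.1) (isClosed_chartTorusGLoc L α w.1 S') (ν'w w.1)))) *
        ((∏ w' : {w : {w : InfinitePlace L // IsComplex w} // ¬ p w}, ((t w'.1 (chartBoxImgGLoc L α w'.1 S')).toReal : ℂ)) *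
          ∫ b' : (∀ w' : {w : {w : InfinitePlace L // IsComplex w} // ¬ p w}, ↥(archLocal L 3 (Matrix.diagonal α) w'.1) ⧸ chartTorusGLoc L α w'.1 S'),
            u ((archPiEquivCM 3 L (Matrix.diagonal α)).symm
              ((MeasurableEquiv.piEquivPiSubtypeProd (fun w : {w : InfinitePlace L // IsComplex w} => ↥(archLocal L 3 (Matrix.diagonal α) w)) p).symm
                (fun w => gprimeBlockAt L α w.1 S' (c w.1),
                  fun w' => descConj (gprimeBlockAt L α w'.1 S' (c w'.1)) (chartTorusGLoc L α w'.1 S') (forall_mem_chartTorusGLoc_comm L α w'.1 S' (c w'.1)) id (b' w'))))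
            ∂(Measure.pi fun w' : {w : {w : InfinitePlace L // IsComplex w} // ¬ p w} =>
                quotientMeasure (chartTorusGLoc L α w'.1 S') (t w'.1) (isClosed_chartTorusGLoc L α w'.1 S') (ν'w w'.1))) := by
  haveI : ∀ w : {w : InfinitePlace L // IsComplex w}, IsClosed (chartTorusGLoc L α w S' : Set ↥(archLocal L 3 (Matrix.diagonal α) w)) :=
    fun w => isClosed_chartTorusGLoc L α w S'
  haveI : ∀ w : {w : InfinitePlace L // IsComplex w}, SecondCountableTopology (↥(archLocal L 3 (Matrix.diagonal α) w) ⧸ chartTorusGLoc L α w S') := fun w => inferInstance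
  haveI : ∀ w : {w : InfinitePlace L // IsComplex w},
      SigmaFinite (quotientMeasure (chartTorusGLoc L α w S') (t w) (isClosed_chartTorusGLoc L α w S') (ν'w w)) := fun w => inferInstance
  rw [chartOrbG_eq_prod_mul_integral_integral_isolate_pred_of_regG L α S' ν'w ν' hν t p hα hS' hc ha'c ha's]
  -- abbreviations: the `¬p`-side reading `U` and the per-place `p`-integrals
  set U : ℂ := ∫ b' : (∀ w' : {w : {w : InfinitePlace L // IsComplex w} // ¬ p w}, ↥(archLocal L 3 (Matrix.diagonal α) w'.1) ⧸ chartTorusGLoc L α w'.1 S'),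
      u ((archPiEquivCM 3 L (Matrix.diagonal α)).symm
        ((MeasurableEquiv.piEquivPiSubtypeProd (fun w : {w : InfinitePlace L // IsComplex w} => ↥(archLocal L 3 (Matrix.diagonal α) w)) p).symm
          (fun w => gprimeBlockAt L α w.1 S' (c w.1),
            fun w' => descConj (gprimeBlockAt L α w'.1 S' (c w'.1)) (chartTorusGLoc L α w'.1 S') (forall_mem_chartTorusGLoc_comm L α w'.1 S' (c w'.1)) id (b' w'))))
      ∂(Measure.pi fun w' : {w : {w : InfinitePlace L // IsComplex w} // ¬ p w} =>
          quotientMeasure (chartTorusGLoc L α w'.1 S') (t w'.1) (isClosed_chartTorusGLoc L α w'.1 S') (ν'w w'.1)) with hU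
  -- the inner integral at the quotient family `y` is `(∏ b_w(ẏγẏ⁻¹)) · U`
  have hinner : ∀ y : (∀ w : {w : {w : InfinitePlace L // IsComplex w} // p w}, ↥(archLocal L 3 (Matrix.diagonal α) w.1) ⧸ chartTorusGLoc L α w.1 S'),
      (∫ b : (∀ w' : {w : {w : InfinitePlace L // IsComplex w} // ¬ p w}, ↥(archLocal L 3 (Matrix.diagonal α) w'.1) ⧸ chartTorusGLoc L α w'.1 S'),
          a' ((archPiEquivCM 3 L (Matrix.diagonal α)).symm fun w =>
            descConj (gprimeBlockAt L α w S' (c w)) (chartTorusGLoc L α w S') (forall_mem_chartTorusGLoc_comm L α w S' (c w)) id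
              ((MeasurableEquiv.piEquivPiSubtypeProd
                  (fun w : {w : InfinitePlace L // IsComplex w} => ↥(archLocal L 3 (Matrix.diagonal α) w) ⧸ chartTorusGLoc L α w S') p).symm (y, b) w))
          ∂(Measure.pi fun w' : {w : {w : InfinitePlace L // IsComplex w} // ¬ p w} =>
              quotientMeasure (chartTorusGLoc L α w'.1 S') (t w'.1) (isClosed_chartTorusGLoc L α w'.1 S') (ν'w w'.1))) =
        (∏ w, bw w (descConj (gprimeBlockAt L α w.1 S' (c w.1)) (chartTorusGLoc L α w.1 S') (forall_mem_chartTorusGLoc_comm L α w.1 S' (c w.1)) id (y w))) * U := by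
    intro y
    rw [hU, ← integral_const_mul]
    refine integral_congr_ae (Filter.Eventually.of_forall fun b => ?_)
    simp only []
    rw [descConj_assembleQuotient_pred_eq L α S' p c y b, hf]
    congr 1
    -- conjugation invariance of `u` at the orbit, on representatives of the quotient points `y w`
    have hy : (fun w : {w : {w : InfinitePlace L // IsComplex w} // p w} =>
        descConj (gprimeBlockAt L α w.1 S' (c w.1)) (chartTorusGLoc L α w.1 S') (forall_mem_chartTorusGLoc_comm L α w.1 S' (c w.1)) id (y w)) =
        fun w => (y w).out * gprimeBlockAt L α w.1 S' (c w.1) * ((y w).out)⁻¹ :=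
      funext fun w => descConj_id_eq_out_conj L α S' c w.1 (y w)
    rw [hy, hu]
  simp_rw [hinner]
  rw [integral_mul_const,
    integral_fintype_prod_eq_prod (fun (w : {w : {w : InfinitePlace L // IsComplex w} // p w})
      (y : ↥(archLocal L 3 (Matrix.diagonal α) w.1) ⧸ chartTorusGLoc L α w.1 S') =>
      bw w (descConj (gprimeBlockAt L α w.1 S' (c w.1)) (chartTorusGLoc L α w.1 S') (forall_mem_chartTorusGLoc_comm L α w.1 S' (c w.1)) id y))]
  -- constants: `Π_w t_w(B′_w) = (Π_{p} …) · (Π_{¬p} …)`, then regroup place by place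
  have hsplit : (∏ w, ((t w (chartBoxImgGLoc L α w S')).toReal : ℂ)) =
      (∏ w : {w : {w : InfinitePlace L // IsComplex w} // p w}, ((t w.1 (chartBoxImgGLoc L α w.1 S')).toReal : ℂ)) *
        ∏ w' : {w : {w : InfinitePlace L // IsComplex w} // ¬ p w}, ((t w'.1 (chartBoxImgGLoc L α w'.1 S')).toReal : ℂ) := by
    convert (Fintype.prod_subtype_mul_prod_subtype p (fun w => ((t w (chartBoxImgGLoc L α w S')).toReal : ℂ))).symm
  rw [hsplit, Finset.prod_mul_distrib]
  ring

end TensorMixed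

end Literature.NumberTheory.Automorphic.UnitaryGroup

end
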